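import Literature.AlgebraicGeometry.HodgeTheory.CyclicCoverPencilFibreEmbedding
import Literature.AlgebraicGeometry.HodgeTheory.CyclicCoverPencilLocalFibre
import Literature.AlgebraicGeometry.HodgeTheory.CyclicCoverMeridianMonodromy
import Literature.AlgebraicGeometry.HodgeTheory.DirectImageIsotopy
import Literature.AlgebraicGeometry.Motives.PeriodRealizationClassical
import Literature.Geometry.Manifold.ShellInterpolatedIsotopyInverse
import HarnessLib

/-!
# The rational transport along a circle of the nodal pencil is the inverse holonomy of the geometric monodromy

Family `hodge`, layer `Literature/AlgebraicGeometry/HodgeTheory`; step A5b of the programme discharging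
`carlsonToledo1999_nodalMeridianLocalMonodromyBound` (crux K1 of
`Summits/HodgeConjecture/HodgeConjecture/Theses/CyclicUnitaryPowers.lean`). Data: a loop `γ₀` at `s₀` in the base `S(ℂ)` of the
Carlson–Toledo family `u = cyclicCoverFamily p` whose branch forms are the circle of the nodal pencil,
`b(γ₀ u) = b(x₃^p − f₁) − e^{2πiu}ε·e_{x₂^p}` (`0 < |ε| < δ₀`), and a fibrewise isotopy `h : ℝ × S → S` of the pencil slice with
its inverse `k` (outputs of `exists_pencil_monodromyMap'`: `h` continuous on `{c ≠ 0}`, `h(0, ·) = id`, `c(h(u, x)) = e^{2πiu}c(x)`,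
`c(k(u, x)) = e^{−2πiu}c(x)`, `k(u, h(u, x)) = x`, `h(u, k(u, x)) = x` over the punctured disc `0 < |c| < δ₀`). Reading the fibres
`X_{γ₀ u}(ℂ)` inside the regular locus (`cycFibreHomeo`, `CyclicCoverPencilFibreEmbedding`), `h(u, ·)` and `k(u, ·)` become continuous
maps `X_{s₀}(ℂ) ⇄ X_{γ₀ u}(ℂ)` inverse to each other, jointly continuous in `u` inside `𝒴(ℂ)`; so by `DirectImageIsotopy`
(Voisin I §9.2.1: the local system is trivialised by any `C⁰` trivialisation) the transport of `R²u_*ℂ` along `γ₀` is `(k(1, ·))^*`,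
which is defined over `ℚ`. Main result `exists_isRatTransport_pencilCircle`: **there is a rational transport `T` along
`cyclicCoverLoopClass p γ₀` together with mutually inverse continuous self-maps `f, r` of `X_{s₀}(ℂ)` reading `h(1, ·)`, `k(1, ·)`, with
`T = r^*`.**

Everything is proved; no definitions, no named facts.

## References

* [VoisinHodgeI2002] C. Voisin, Hodge Theory and Complex Algebraic Geometry I, §9.2.1, Prop. 9.5.
* [CarlsonToledo1999] J. A. Carlson, D. Toledo, Duke Math. J. 97 (1999), §2 (universalcyclic), §6 (kdoublept).
* [ArnoldGuseinzadeVarchenko2012] V. I. Arnold, S. M. Gusein-Zade, A. N. Varchenko, Singularities of Differentiable Maps II, Part I §1.1, §2.1.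
-/

noncomputable section

open CategoryTheory AlgebraicGeometry MvPolynomial TopologicalSpace Set Topology Filter
open scoped Real unitInterval
open Literature.AlgebraicGeometry.Motives Literature.AlgebraicGeometry.Motives.UniversalHypersurface
open Literature.AlgebraicGeometry.HodgeTheory.UniversalHypersurface Literature.Geometry.ComplexAnalytic Literature.Geometry.Manifold
open Literature.AlgebraicTopology.SingularHomology

namespace Literature.AlgebraicGeometry.HodgeTheory

section Transport

variable {p : ℕ} [NeZero p] (hp : 3 ≤ p) {δ₀ : ℝ}
  (h k : ℝ × pencilSlice p → pencilSlice p)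
  (hhc : Continuous fun ux : ℝ × {x : pencilSlice p // pencilCoord p x.1 ≠ 0} => h (ux.1, ux.2.1))
  (hh0 : ∀ x, pencilCoord p x.1 ≠ 0 → h (0, x) = x)
  (hhk : ∀ u x, pencilCoord p x.1 ≠ 0 → ‖pencilCoord p x.1‖ < δ₀ →
    pencilCoord p (h (u, x)).1 = Complex.exp (((2 * π * u : ℝ) : ℂ) * Complex.I) * pencilCoord p x.1 ∧
    k (u, h (u, x)) = x ∧ h (u, k (u, x)) = x ∧
    pencilCoord p (k (u, x)).1 = Complex.exp (((-(2 * π * u) : ℝ) : ℂ) * Complex.I) * pencilCoord p x.1)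
  {ε : ℂ} (hε0 : ε ≠ 0) (hεδ : ‖ε‖ < δ₀)
  {s₀ : ComplexPoints (cyclicCoverBase p)} (γ₀ : Path s₀ s₀)
  (hγ : ∀ u : I, coeffVector ℂ 2 p (AlgPoints.map (toBaseSpz ℂ 2 p (cyclicCoverSpz p)) (γ₀ u)) =
    coeffsOf 2 p (cyclicCoverForm p (X 2 ^ (p - 2) * (X 0 * X 1) + X 0 ^ p + X 1 ^ p)) -
      Pi.single (regPowIndex 2 p 2) (Complex.exp (((2 * π * u : ℝ) : ℂ) * Complex.I) * ε))
include hp hhc hh0 hhk hε0 hεδ hγ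

omit [NeZero p] hp hhc hh0 hhk hε0 hεδ in
/-- The base point: `b(s₀) = b(x₃^p − f₁) − ε·e_{x₂^p}`. [cite: CarlsonToledo1999, §6 (kdoublept)] -/
theorem transport_coeff_base :
    coeffVector ℂ 2 p (AlgPoints.map (toBaseSpz ℂ 2 p (cyclicCoverSpz p)) s₀) =
      coeffsOf 2 p (cyclicCoverForm p (X 2 ^ (p - 2) * (X 0 * X 1) + X 0 ^ p + X 1 ^ p)) - Pi.single (regPowIndex 2 p 2) ε := by
  have h0 := hγ 0
  rw [γ₀.source] at h0
  rw [h0]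
  norm_num

omit [NeZero p] hhc hh0 hhk hγ in
/-- A point over a base point of the circle lies in the slice with pencil coordinate `e^{2πiu}ε`. [cite: CarlsonToledo1999, §6 (kdoublept)] -/
theorem transport_mem_of_regCoeff {u : ℝ} {Q : ComplexPoints (regularTotal ℂ 2 p)}
    (hQ : regCoeff ℂ 2 p Q = coeffsOf 2 p (cyclicCoverForm p (X 2 ^ (p - 2) * (X 0 * X 1) + X 0 ^ p + X 1 ^ p)) -
      Pi.single (regPowIndex 2 p 2) (Complex.exp (((2 * π * u : ℝ) : ℂ) * Complex.I) * ε)) :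
    Q ∈ pencilSlice p ∧ pencilCoord p Q = Complex.exp (((2 * π * u : ℝ) : ℂ) * Complex.I) * ε ∧
      pencilCoord p Q ≠ 0 ∧ ‖pencilCoord p Q‖ < δ₀ := by
  obtain ⟨hS, hc⟩ := (mem_pencilFibre_iff_regCoeff_eq hp _ Q).mpr hQ
  refine ⟨hS, hc, ?_, ?_⟩
  · rw [hc]; exact mul_ne_zero (Complex.exp_ne_zero _) hε0
  · rw [hc, norm_exp_ofReal_mul_I_mul]; exact hεδ

/-- **The rational transport along the pencil circle is the inverse holonomy of the geometric monodromy.** There are a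
rational transport `T` of `R²u_*ℚ` along `cyclicCoverLoopClass p γ₀` and continuous self-maps `f, r` of `X_{s₀}(ℂ)`, inverse to each
other, reading `h(1, ·)` and `k(1, ·)` through `ι_{s₀} : X_{s₀}(ℂ) ↪ 𝒴°(ℂ)`, such that `T = r^*` on `H²(X_{s₀}(ℂ); ℚ)`.
[cite: VoisinHodgeI2002, §9.2.1 and Prop. 9.5] [cite: CarlsonToledo1999, §6 (kdoublept)] -/
theorem exists_isRatTransport_pencilCircle :
    ∃ (f r : C(ComplexPoints (fiberOver (cyclicCoverFamily p) s₀), ComplexPoints (fiberOver (cyclicCoverFamily p) s₀)))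
      (T : bettiCohomology (fiberOver (cyclicCoverFamily p) s₀) 2 ≃ₗ[ℚ] bettiCohomology (fiberOver (cyclicCoverFamily p) s₀) 2),
      (∀ y, ∃ hy : cycFibreToReg p s₀ y ∈ pencilSlice p,
        cycFibreToReg p s₀ (f y) = (h (1, ⟨cycFibreToReg p s₀ y, hy⟩)).1 ∧
        cycFibreToReg p s₀ (r y) = (k (1, ⟨cycFibreToReg p s₀ y, hy⟩)).1) ∧
      (∀ y, r (f y) = y) ∧ (∀ y, f (r y) = y) ∧
      IsRatTransport (cyclicCoverFamily p) 2 (cyclicCoverFamily_locallyTrivial p) (cyclicCoverLoopClass p γ₀) T ∧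
      ∀ v, T v = (singularCohomology.map ℚ ℚ r 2).hom v := by
  -- notation
  have hs₀ := transport_coeff_base γ₀ hγ
  set b₀ := coeffsOf 2 p (cyclicCoverForm p (X 2 ^ (p - 2) * (X 0 * X 1) + X 0 ^ p + X 1 ^ p)) with hb₀
  set m₀ := regPowIndex 2 p 2 with hm₀
  let rot : ℝ → ℂ := fun u => Complex.exp (((2 * π * u : ℝ) : ℂ) * Complex.I)
  have hs₀' : coeffVector ℂ 2 p (AlgPoints.map (toBaseSpz ℂ 2 p (cyclicCoverSpz p)) s₀) = b₀ - Pi.single m₀ (rot 0 * ε) := by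
    rw [hs₀]; simp [rot]
  -- points of the fibres as good points of the slice
  have hsrc : ∀ y : ComplexPoints (fiberOver (cyclicCoverFamily p) s₀),
      cycFibreToReg p s₀ y ∈ pencilSlice p ∧ pencilCoord p (cycFibreToReg p s₀ y) = rot 0 * ε ∧
        pencilCoord p (cycFibreToReg p s₀ y) ≠ 0 ∧ ‖pencilCoord p (cycFibreToReg p s₀ y)‖ < δ₀ := fun y =>
    transport_mem_of_regCoeff hp hε0 hεδ ((regCoeff_cycFibreToReg p s₀ y).trans hs₀')
  have htgt : ∀ (u : ℝ) (t : ComplexPoints (cyclicCoverBase p))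
      (ht : coeffVector ℂ 2 p (AlgPoints.map (toBaseSpz ℂ 2 p (cyclicCoverSpz p)) t) = b₀ - Pi.single m₀ (rot u * ε))
      (y : ComplexPoints (fiberOver (cyclicCoverFamily p) t)),
      cycFibreToReg p t y ∈ pencilSlice p ∧ pencilCoord p (cycFibreToReg p t y) = rot u * ε ∧
        pencilCoord p (cycFibreToReg p t y) ≠ 0 ∧ ‖pencilCoord p (cycFibreToReg p t y)‖ < δ₀ := fun u t ht y =>
    transport_mem_of_regCoeff hp hε0 hεδ ((regCoeff_cycFibreToReg p t y).trans ht)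
  -- the forward fibre maps `h(u, ·)` read in the fibres
  have hfwd_coeff : ∀ (u : ℝ) (t : ComplexPoints (cyclicCoverBase p))
      (ht : coeffVector ℂ 2 p (AlgPoints.map (toBaseSpz ℂ 2 p (cyclicCoverSpz p)) t) = b₀ - Pi.single m₀ (rot u * ε))
      (y : ComplexPoints (fiberOver (cyclicCoverFamily p) s₀)),
      regCoeff ℂ 2 p (h (u, ⟨cycFibreToReg p s₀ y, (hsrc y).1⟩)).1 =
        coeffVector ℂ 2 p (AlgPoints.map (toBaseSpz ℂ 2 p (cyclicCoverSpz p)) t) := by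
    intro u t ht y
    obtain ⟨hS, hc, hc0, hcδ⟩ := hsrc y
    obtain ⟨hpc, -, -, -⟩ := hhk u ⟨cycFibreToReg p s₀ y, hS⟩ hc0 hcδ
    have key : (h (u, ⟨cycFibreToReg p s₀ y, hS⟩)).1 ∈ pencilFibre p (rot u * ε) := by
      refine ⟨(h (u, ⟨cycFibreToReg p s₀ y, hS⟩)).2, ?_⟩
      rw [hpc]
      change Complex.exp (((2 * π * u : ℝ) : ℂ) * Complex.I) * pencilCoord p (cycFibreToReg p s₀ y) = rot u * ε
      rw [hc]; simp [rot]
    exact ((mem_pencilFibre_iff_regCoeff_eq hp _ _).mp key).trans ht.symm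
  have hbwd_coeff : ∀ (u : ℝ) (t : ComplexPoints (cyclicCoverBase p))
      (ht : coeffVector ℂ 2 p (AlgPoints.map (toBaseSpz ℂ 2 p (cyclicCoverSpz p)) t) = b₀ - Pi.single m₀ (rot u * ε))
      (y : ComplexPoints (fiberOver (cyclicCoverFamily p) t)),
      regCoeff ℂ 2 p (k (u, ⟨cycFibreToReg p t y, (htgt u t ht y).1⟩)).1 =
        coeffVector ℂ 2 p (AlgPoints.map (toBaseSpz ℂ 2 p (cyclicCoverSpz p)) s₀) := by
    intro u t ht y
    obtain ⟨hS, hc, hc0, hcδ⟩ := htgt u t ht y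
    obtain ⟨-, -, -, hpk⟩ := hhk u ⟨cycFibreToReg p t y, hS⟩ hc0 hcδ
    have key : (k (u, ⟨cycFibreToReg p t y, hS⟩)).1 ∈ pencilFibre p ε := by
      refine ⟨(k (u, ⟨cycFibreToReg p t y, hS⟩)).2, ?_⟩
      rw [hpk]
      change Complex.exp (((-(2 * π * u) : ℝ) : ℂ) * Complex.I) * pencilCoord p (cycFibreToReg p t y) = ε
      rw [hc]
      change Complex.exp (((-(2 * π * u) : ℝ) : ℂ) * Complex.I) * (Complex.exp (((2 * π * u : ℝ) : ℂ) * Complex.I) * ε) = ε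
      rw [exp_mul_I_mul_exp_mul_I_mul]
      simp
    exact ((mem_pencilFibre_iff_regCoeff_eq hp _ _).mp key).trans hs₀.symm
  -- topology of the fibres
  haveI hT2 : T2Space (ComplexPoints (regularTotal ℂ 2 p)) := t2Space_regularTotal 2 p
  haveI hcpt : CompactSpace (ComplexPoints (fiberOver (cyclicCoverFamily p) s₀)) := compactSpace_cycFibre p s₀
  have hT2t : ∀ t : ComplexPoints (cyclicCoverBase p), T2Space (ComplexPoints (fiberOver (cyclicCoverFamily p) t)) := fun t =>
    (isClosedEmbedding_cycFibreToReg p t).isEmbedding.t2Space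
  -- the fibre maps as equivalences
  let fwdFun : ∀ (u : ℝ) (t : ComplexPoints (cyclicCoverBase p)),
      coeffVector ℂ 2 p (AlgPoints.map (toBaseSpz ℂ 2 p (cyclicCoverSpz p)) t) = b₀ - Pi.single m₀ (rot u * ε) →
      ComplexPoints (fiberOver (cyclicCoverFamily p) s₀) → ComplexPoints (fiberOver (cyclicCoverFamily p) t) :=
    fun u t ht y => (cycFibreHomeo p t).symm ⟨(h (u, ⟨cycFibreToReg p s₀ y, (hsrc y).1⟩)).1, hfwd_coeff u t ht y⟩
  let bwdFun : ∀ (u : ℝ) (t : ComplexPoints (cyclicCoverBase p)),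
      coeffVector ℂ 2 p (AlgPoints.map (toBaseSpz ℂ 2 p (cyclicCoverSpz p)) t) = b₀ - Pi.single m₀ (rot u * ε) →
      ComplexPoints (fiberOver (cyclicCoverFamily p) t) → ComplexPoints (fiberOver (cyclicCoverFamily p) s₀) :=
    fun u t ht y => (cycFibreHomeo p s₀).symm ⟨(k (u, ⟨cycFibreToReg p t y, (htgt u t ht y).1⟩)).1, hbwd_coeff u t ht y⟩
  have hfwd_val : ∀ u t ht y, cycFibreToReg p t (fwdFun u t ht y) = (h (u, ⟨cycFibreToReg p s₀ y, (hsrc y).1⟩)).1 :=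
    fun u t ht y => cycFibreToReg_symm_apply p t _
  have hbwd_val : ∀ u t ht y, cycFibreToReg p s₀ (bwdFun u t ht y) = (k (u, ⟨cycFibreToReg p t y, (htgt u t ht y).1⟩)).1 :=
    fun u t ht y => cycFibreToReg_symm_apply p s₀ _
  have hleft : ∀ u t ht y, bwdFun u t ht (fwdFun u t ht y) = y := by
    intro u t ht y
    obtain ⟨hS, hc, hc0, hcδ⟩ := hsrc y
    obtain ⟨-, hkh, -, -⟩ := hhk u ⟨cycFibreToReg p s₀ y, hS⟩ hc0 hcδ
    apply cycFibreToReg_injective p s₀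
    rw [hbwd_val u t ht]
    have e1 : (⟨cycFibreToReg p t (fwdFun u t ht y), (htgt u t ht (fwdFun u t ht y)).1⟩ : pencilSlice p) =
        h (u, ⟨cycFibreToReg p s₀ y, hS⟩) := Subtype.ext (hfwd_val u t ht y)
    rw [e1, hkh]
  have hright : ∀ u t ht y, fwdFun u t ht (bwdFun u t ht y) = y := by
    intro u t ht y
    obtain ⟨hS, hc, hc0, hcδ⟩ := htgt u t ht y
    obtain ⟨-, -, hhk', -⟩ := hhk u ⟨cycFibreToReg p t y, hS⟩ hc0 hcδ
    apply cycFibreToReg_injective p t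
    rw [hfwd_val u t ht]
    have e1 : (⟨cycFibreToReg p s₀ (bwdFun u t ht y), (hsrc (bwdFun u t ht y)).1⟩ : pencilSlice p) =
        k (u, ⟨cycFibreToReg p t y, hS⟩) := Subtype.ext (hbwd_val u t ht y)
    rw [e1, hhk']
  have hfwd_cont : ∀ u t ht, Continuous (fwdFun u t ht) := by
    intro u t ht
    refine (cycFibreHomeo p t).symm.continuous.comp (Continuous.subtype_mk ?_ _)
    have hin : Continuous fun y : ComplexPoints (fiberOver (cyclicCoverFamily p) s₀) =>
        ((u, ⟨⟨cycFibreToReg p s₀ y, (hsrc y).1⟩, (hsrc y).2.2.1⟩) : ℝ × {x : pencilSlice p // pencilCoord p x.1 ≠ 0}) :=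
      continuous_const.prodMk (((cycFibreToReg p s₀).continuous.subtype_mk _).subtype_mk _)
    exact continuous_subtype_val.comp (hhc.comp hin)
  -- the fibre homeomorphisms (continuous bijections from a compact space to a Hausdorff space)
  let Hom : ∀ (u : ℝ) (t : ComplexPoints (cyclicCoverBase p)),
      coeffVector ℂ 2 p (AlgPoints.map (toBaseSpz ℂ 2 p (cyclicCoverSpz p)) t) = b₀ - Pi.single m₀ (rot u * ε) →
      ComplexPoints (fiberOver (cyclicCoverFamily p) s₀) ≃ₜ ComplexPoints (fiberOver (cyclicCoverFamily p) t) :=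
    fun u t ht =>
      haveI := hT2t t
      Continuous.homeoOfEquivCompactToT2
        (f := { toFun := fwdFun u t ht, invFun := bwdFun u t ht, left_inv := hleft u t ht, right_inv := hright u t ht })
        (hfwd_cont u t ht)
  have hHom_apply : ∀ u t ht y, Hom u t ht y = fwdFun u t ht y := fun u t ht y => rfl
  have hHom_symm_apply : ∀ u t ht y, (Hom u t ht).symm y = bwdFun u t ht y := fun u t ht y => rfl
  -- the loop and its lift to the coefficient condition
  have hγ' : ∀ u : I, coeffVector ℂ 2 p (AlgPoints.map (toBaseSpz ℂ 2 p (cyclicCoverSpz p)) (γ₀ u)) =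
      b₀ - Pi.single m₀ (rot u * ε) := fun u => hγ u
  let γ : Path (⟨s₀, Set.mem_univ s₀⟩ : (Set.univ : Set (ComplexPoints (cyclicCoverBase p)))) ⟨s₀, Set.mem_univ s₀⟩ :=
    γ₀.map (continuous_id.subtype_mk fun x : ComplexPoints (cyclicCoverBase p) => Set.mem_univ x)
  have hγ'' : ∀ u : I, coeffVector ℂ 2 p (AlgPoints.map (toBaseSpz ℂ 2 p (cyclicCoverSpz p)) (γ u).1) =
      b₀ - Pi.single m₀ (rot u * ε) := fun u => hγ u
  let hfam : ∀ u : I, C(ComplexPoints (fiberOver (cyclicCoverFamily p) s₀), ComplexPoints (fiberOver (cyclicCoverFamily p) (γ u).1)) :=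
    fun u => (Hom u (γ u).1 (hγ'' u) : C(ComplexPoints (fiberOver (cyclicCoverFamily p) s₀), ComplexPoints (fiberOver (cyclicCoverFamily p) (γ u).1)))
  -- joint continuity inside `𝒴(ℂ)`
  have hcont : Continuous fun yu : ComplexPoints (fiberOver (cyclicCoverFamily p) s₀) × I =>
      AlgPoints.map (fiberι (cyclicCoverFamily p) (γ yu.2).1) (hfam yu.2 yu.1) := by
    have hin : Continuous fun yu : ComplexPoints (fiberOver (cyclicCoverFamily p) s₀) × I =>
        (((yu.2 : ℝ), ⟨⟨cycFibreToReg p s₀ yu.1, (hsrc yu.1).1⟩, (hsrc yu.1).2.2.1⟩) :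
          ℝ × {x : pencilSlice p // pencilCoord p x.1 ≠ 0}) :=
      (continuous_subtype_val.comp continuous_snd).prodMk
        ((((cycFibreToReg p s₀).continuous.comp continuous_fst).subtype_mk _).subtype_mk _)
    have hf : Continuous fun yu : ComplexPoints (fiberOver (cyclicCoverFamily p) s₀) × I =>
        (h ((yu.2 : ℝ), ⟨cycFibreToReg p s₀ yu.1, (hsrc yu.1).1⟩)).1 :=
      continuous_subtype_val.comp (hhc.comp hin)
    have hγc : Continuous fun yu : ComplexPoints (fiberOver (cyclicCoverFamily p) s₀) × I => (γ yu.2).1 :=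
      continuous_subtype_val.comp (γ.continuous.comp continuous_snd)
    exact continuous_map_fiberι_cycFibreHomeo_symm p (fun yu : ComplexPoints (fiberOver (cyclicCoverFamily p) s₀) × I => (γ yu.2).1) hγc _ hf
      (fun yu => hfwd_coeff yu.2 (γ yu.2).1 (hγ'' yu.2) yu.1)
  -- injectivity of `h_u^*` (a homeomorphism) and the transported classes
  have hinj : ∀ u : I, Function.Injective (singularCohomology.map ℂ ℂ (hfam u) 2) := fun u =>
    (singularCohomology.mapIso ℂ ℂ (Hom u (γ u).1 (hγ'' u)) 2).toLinearEquiv.injective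
  have hcomp : ∀ u t ht, ((Hom u t ht).symm : C(ComplexPoints (fiberOver (cyclicCoverFamily p) t), ComplexPoints (fiberOver (cyclicCoverFamily p) s₀))).comp (Hom u t ht : C(ComplexPoints (fiberOver (cyclicCoverFamily p) s₀), ComplexPoints (fiberOver (cyclicCoverFamily p) t))) =
      ContinuousMap.id (ComplexPoints (fiberOver (cyclicCoverFamily p) s₀)) := fun u t ht => by
    exact ContinuousMap.ext fun y => (Hom u t ht).symm_apply_apply y
  have hcancel : ∀ u t ht (a : singularCohomology ℂ ℂ (ComplexPoints (fiberOver (cyclicCoverFamily p) s₀)) 2),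
      singularCohomology.map ℂ ℂ (Hom u t ht : C(ComplexPoints (fiberOver (cyclicCoverFamily p) s₀), ComplexPoints (fiberOver (cyclicCoverFamily p) t))) 2
        (singularCohomology.map ℂ ℂ ((Hom u t ht).symm : C(ComplexPoints (fiberOver (cyclicCoverFamily p) t), ComplexPoints (fiberOver (cyclicCoverFamily p) s₀))) 2 a) = a := by
    intro u t ht a
    rw [← ModuleCat.comp_apply, ← singularCohomology.map_comp, hcomp u t ht, singularCohomology.map_id]
    rfl
  -- the time-one maps and the rational transport
  have h1 : coeffVector ℂ 2 p (AlgPoints.map (toBaseSpz ℂ 2 p (cyclicCoverSpz p)) s₀) = b₀ - Pi.single m₀ (rot 1 * ε) := by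
    have := hγ' 1; rwa [γ₀.target] at this
  let η : ComplexPoints (fiberOver (cyclicCoverFamily p) s₀) ≃ₜ ComplexPoints (fiberOver (cyclicCoverFamily p) s₀) := Hom 1 s₀ h1
  let T : bettiCohomology (fiberOver (cyclicCoverFamily p) s₀) 2 ≃ₗ[ℚ] bettiCohomology (fiberOver (cyclicCoverFamily p) s₀) 2 :=
    (singularCohomology.mapIso ℚ ℚ η.symm 2).toLinearEquiv
  have hT : ∀ v, T v = (singularCohomology.map ℚ ℚ (η.symm : C(ComplexPoints (fiberOver (cyclicCoverFamily p) s₀), ComplexPoints (fiberOver (cyclicCoverFamily p) s₀))) 2).hom v := fun v => rfl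
  refine ⟨(η : C(ComplexPoints (fiberOver (cyclicCoverFamily p) s₀), ComplexPoints (fiberOver (cyclicCoverFamily p) s₀))), (η.symm : C(ComplexPoints (fiberOver (cyclicCoverFamily p) s₀), ComplexPoints (fiberOver (cyclicCoverFamily p) s₀))), T, fun y => ⟨(hsrc y).1, ?_, ?_⟩, fun y => η.symm_apply_apply y,
    fun y => η.apply_symm_apply y, ?_, hT⟩
  · exact hfwd_val 1 s₀ h1 y
  · change cycFibreToReg p s₀ (bwdFun 1 s₀ h1 y) = _
    rw [hbwd_val 1 s₀ h1]
  -- the transport: `DirectImageIsotopy` with the classes `c u = (H_u⁻¹)^* a`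
  intro v
  set a : singularCohomology ℂ ℂ (ComplexPoints (fiberOver (cyclicCoverFamily p) s₀)) 2 := ofRatClass _ 2 v with ha
  let c : ∀ u : I, complexBetti (fiberOver (cyclicCoverFamily p) (γ u).1) 2 := fun u =>
    singularCohomology.map ℂ ℂ ((Hom u (γ u).1 (hγ'' u)).symm :
      C(ComplexPoints (fiberOver (cyclicCoverFamily p) (γ u).1), ComplexPoints (fiberOver (cyclicCoverFamily p) s₀))) 2 a
  have hc : ∀ u, singularCohomology.map ℂ ℂ (hfam u) 2 (c u) = a := fun u => hcancel u (γ u).1 (hγ'' u) a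
  -- endpoint identifications
  have hstart : ∀ (t : (Set.univ : Set (ComplexPoints (cyclicCoverBase p))))
      (ht : coeffVector ℂ 2 p (AlgPoints.map (toBaseSpz ℂ 2 p (cyclicCoverSpz p)) t.1) = b₀ - Pi.single m₀ (rot 0 * ε)),
      t = ⟨s₀, Set.mem_univ s₀⟩ →
      (⟨t.1, singularCohomology.map ℂ ℂ ((Hom 0 t.1 ht).symm :
        C(ComplexPoints (fiberOver (cyclicCoverFamily p) t.1), ComplexPoints (fiberOver (cyclicCoverFamily p) s₀))) 2 a⟩ :
        FiberClass (cyclicCoverFamily p) 2) = ⟨s₀, a⟩ := by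
    rintro t ht rfl
    refine (FiberClass.mk_eq_mk_iff _ _).mpr ?_
    -- `H_0 = id` since `h(0, ·) = id`
    have hid : ((Hom 0 s₀ ht).symm : C(ComplexPoints (fiberOver (cyclicCoverFamily p) s₀), ComplexPoints (fiberOver (cyclicCoverFamily p) s₀))) = ContinuousMap.id (ComplexPoints (fiberOver (cyclicCoverFamily p) s₀)) := by
      refine ContinuousMap.ext fun y => ?_
      rw [ContinuousMap.id_apply, ContinuousMap.coe_coe, hHom_symm_apply 0 s₀ ht y]
      have hfix : fwdFun 0 s₀ ht y = y :=
        cycFibreToReg_injective p s₀ (by rw [hfwd_val 0 s₀ ht y, hh0 ⟨cycFibreToReg p s₀ y, (hsrc y).1⟩ (hsrc y).2.2.1])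
      calc bwdFun 0 s₀ ht y = bwdFun 0 s₀ ht (fwdFun 0 s₀ ht y) := by rw [hfix]
        _ = y := hleft 0 s₀ ht y
    rw [hid, singularCohomology.map_id]; rfl
  have hend : ∀ (t : ComplexPoints (cyclicCoverBase p))
      (ht : coeffVector ℂ 2 p (AlgPoints.map (toBaseSpz ℂ 2 p (cyclicCoverSpz p)) t) = b₀ - Pi.single m₀ (rot 1 * ε))
      (e : t = s₀),
      (⟨t, singularCohomology.map ℂ ℂ ((Hom 1 t ht).symm :
        C(ComplexPoints (fiberOver (cyclicCoverFamily p) t), ComplexPoints (fiberOver (cyclicCoverFamily p) s₀))) 2 a⟩ :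
        FiberClass (cyclicCoverFamily p) 2) =
        ⟨s₀, singularCohomology.map ℂ ℂ (η.symm : C(ComplexPoints (fiberOver (cyclicCoverFamily p) s₀), ComplexPoints (fiberOver (cyclicCoverFamily p) s₀))) 2 a⟩ := by
    rintro t ht rfl
    rfl
  have h0 : (⟨(γ 0).1, c 0⟩ : FiberClass (cyclicCoverFamily p) 2) = ⟨s₀, a⟩ := hstart (γ 0) (hγ'' 0) γ.source
  have h1' : (⟨(γ 1).1, c 1⟩ : FiberClass (cyclicCoverFamily p) 2) =
      ⟨s₀, singularCohomology.map ℂ ℂ (η.symm : C(ComplexPoints (fiberOver (cyclicCoverFamily p) s₀), ComplexPoints (fiberOver (cyclicCoverFamily p) s₀))) 2 a⟩ :=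
    hend (γ 1).1 (hγ'' 1) (congrArg Subtype.val γ.target)
  have htr := transportFun_eq_of_isotopy (cyclicCoverFamily p) 2 (cyclicCoverFamily_locallyTrivial p) γ hfam hcont hinj c a hc
    h0 h1'
  -- rationality: `ofRatClass (r^* v) = r^* (ofRatClass v)`
  rw [hT, ofRatClass_map]
  change _ = transportFun (cyclicCoverFamily p) 2 (cyclicCoverFamily_locallyTrivial p) ⟦γ⟧ a
  rw [htr]

end Transport

end Literature.AlgebraicGeometry.HodgeTheory

end
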